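import Literature.NumberTheory.Transcendental.AnalytificationChartsProofs
import Literature.AlgebraicGeometry.Motives.AlgPointsProperProofs
import Literature.NumberTheory.Transcendental.SemialgebraicMapsProofs
import Mathlib.AlgebraicGeometry.Noetherian
import HarnessLib

/-!
# Algebraic coordinates on the points of a scheme: embedding `X(L)` in affine space

Let `k` be a field, `L` a field extension (`[Algebra k L]`; the case of interest is `k ⊆ ℝ = L`)
and `X` a `k`-scheme. An **algebraic coordinate system** on the `L`-points of `X` is a finite
family of regular functions `f₁, …, f_N ∈ Γ(X, V)` on an open `V ⊆ X` containing (the underlying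
points of) all `L`-points, which Zariski-locally generates the regular functions after inverting
one polynomial in the `f_j`: every `L`-point has an affine open neighbourhood `W ⊆ V` and a
polynomial `b ∈ k[y₁, …, y_N]` such that `W(L) = {Q | b(f(Q)) ≠ 0}`, `b(f)|_W` is a unit of
`Γ(X, W)` and every `s ∈ Γ(X, W)` is `a(f)/b(f)^m` for some `a ∈ k[y]`, `m ∈ ℕ`
(`IsAlgCoordSystem`). The model: `X ⊆ ℙⁿ_k` closed and the `(n+1)²` functions
`x_a x_b / Σ_c x_c²` on `V = X ∖ {Σ x_c² = 0}`, which contains every real point; on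
`W = X ∩ D₊(xᵢ · Σ x_c²)` one inverts `b = y_{ii}` (Akbulut–King, *Topology of Real Algebraic
Sets*, II §4, Prop. 2.4.1: `ℝPⁿ ≅ {symmetric idempotents of rank 1} ⊂ ℝ^{(n+1)²}`, and projective
real algebraic sets are affine, Cor. 2.4.2; Bochnak–Coste–Roy, *Real Algebraic Geometry*,
Thm. 3.4.4). This file develops the consequences of the definition, for any such system:

* `coordMap L V f : X(L) → L^N`, `Q ↦ (f_j(Q))_j`, is continuous for the strong topology and
  injective (`IsAlgCoordSystem.injective`: points of an affine open are separated by its regular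
  functions); for `X` proper over `k` and `L` a locally compact normed field it is a closed
  embedding with compact image (`IsAlgCoordSystem.isClosedEmbedding`; compactness of `X(L)` is the
  tree's `compactSpace_algPoints_of_isProper_holds`).
* **Regular functions are rational functions of the coordinates** (`exists_fraction_eval`): for
  `s ∈ Γ(X, U)` and `P ∈ U(L)` there are `c, A, B ∈ k[y]` with `c(f(P)) ≠ 0` and
  `s(Q) = A(f(Q))/B(f(Q))`, `B(f(Q)) ≠ 0`, `Q ∈ U`, for every `L`-point `Q` with `c(f(Q)) ≠ 0`
  (Serre's «les fonctions régulières sont localement des fractions», GAGA §2 n°5 Lemme 1, through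
  the tree's `AlgPoints.exists_fraction`). Over `L = ℝ` this gives, near each real point, a
  real-analytic function on an open `k`-semialgebraic subset of `ℝ^N` restricting to `s`
  (`exists_analyticOnNhd_eval`).
* **Images are semialgebraic** (`L = ℝ`, `X` Noetherian): the image of `W(ℝ)` for a chart `W` is
  the projection of the real algebraic set `{(v, u) | u · b(v) = 1, r(v, u) = 0 ∀ r ∈ G}` for a
  finite set `G` of relations (`image_coordMap_chart`), hence `k`-semialgebraic by the
  Tarski–Seidenberg theorem; finitely many charts cover the real points (Noetherian induction), so
  the image of `X(ℝ)`, and of `U(ℝ)` for every open `U`, is `k`-semialgebraic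
  (`isSemialgebraic_range_coordMap`, `isSemialgebraic_image_coordMap`), and every regular function
  on every open `U` is a `k`-semialgebraic function of the coordinates on the image of `U(ℝ)`
  (`exists_isSemialgebraicFunOn_eval`). When `k` maps into the real algebraic numbers all of these
  are `ℚ`-semialgebraic (`IsSemialgebraic.rat_of_isAlgebraic` of
  `RealAlgebraic/SemialgebraicOverRealAlgebraicField`).

This is the second layer of the construction of the real Abel–Jacobi package
(`RealAlgebraic/RealAbelJacobi`, named fact `RealAbelJacobi.exists_realization`), whose
`Realization` structure asks exactly for such coordinates on `C(ℝ)` and `J(ℝ)`. The existence of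
algebraic coordinate systems for projective `X` (the Veronese-type coordinates above), their
behaviour under products and morphisms, and the submanifold structure of the image for smooth `X`
are the subject of sibling files. No named fact is introduced.

## References

* S. Akbulut, H. King, *Topology of Real Algebraic Sets*, MSRI Publ. 25 (1992), Ch. II §§1–4,
  Prop. 2.4.1, Cor. 2.4.2. [AkbulutKing1992]
* J. Bochnak, M. Coste, M.-F. Roy, *Real Algebraic Geometry* (1998), Prop. 2.2.7, §3.2
  (regular functions), Thm. 3.4.4. [BochnakCosteRoy1998]
* J.-P. Serre, *Géométrie algébrique et géométrie analytique*, Ann. Inst. Fourier 6 (1956), §2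
  n°5 Lemme 1. [SerreGAGA1956]
-/

noncomputable section

universe u

open CategoryTheory AlgebraicGeometry MvPolynomial Set TopologicalSpace
open _root_.Topology
open scoped ContDiff

namespace Literature.AlgebraicGeometry.RealAlgebraic

open Literature.AlgebraicGeometry.Motives Literature.NumberTheory.Transcendental
  Literature.ModelTheory.ExponentialFields

section General

variable {k : Type u} [Field k] {X : SchemeOver k} {N : ℕ}

/-! ### Coordinates attached to regular functions -/

section Defs

variable (L : Type u) [Field L] [Algebra k L]

/-- The **coordinate map** `X(L) → L^N`, `Q ↦ (f₁(Q), …, f_N(Q))`, attached to regular functions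
`f₁, …, f_N ∈ Γ(X, V)` (total: the value of `f_j` at a point outside `V` is the junk value `0` of
`AlgPoints.evalOrZero`; only points of `V(L)` are meaningful). [folklore] -/
def coordMap (V : X.left.Opens) (f : Fin N → Γ(X.left, V)) : AlgPoints X L → (Fin N → L) :=
  fun P j => AlgPoints.evalOrZero V (f j) P

variable {L}

/-- The regular function `b(f₁|_W, …, f_N|_W) ∈ Γ(X, W)` obtained by substituting the restricted
coordinates into a polynomial `b ∈ k[y₁, …, y_N]` (scalars through `k → Γ(X, W)`). [folklore] -/
def pullbackPoly {V W : X.left.Opens} (hWV : W ≤ V) (f : Fin N → Γ(X.left, V))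
    (b : MvPolynomial (Fin N) k) : Γ(X.left, W) :=
  MvPolynomial.eval₂ (SchemeOver.scalarRingHom X W)
    (fun j => X.left.presheaf.map (homOfLE hWV).op (f j)) b

variable (L)

/-- An **algebraic coordinate system on the `L`-points of `X`**: regular functions
`f₁, …, f_N ∈ Γ(X, V)` on an open `V` containing every `L`-point, such that every `L`-point has an
affine open neighbourhood `W ⊆ V` and a polynomial `b ∈ k[y₁, …, y_N]` with
(i) `W(L) = {Q ∈ X(L) | b(f(Q)) ≠ 0}`, (ii) `b(f)|_W` a unit of `Γ(X, W)`, and (iii) every regular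
function on `W` of the form `a(f)/b(f)^m`, `a ∈ k[y]`. Model: the functions `x_a x_b/Σ x_c²` on a
closed subscheme of `ℙⁿ_k`, `L` formally real (Akbulut–King II §4, Prop. 2.4.1 and Cor. 2.4.2:
projective real algebraic sets are affine via `ℝPⁿ ↪ ℝ^{(n+1)²}`; Bochnak–Coste–Roy Thm. 3.4.4).
This is a predicate (a definition), not an assertion. [cite: AkbulutKing1992, Ch. II §4, Prop. 2.4.1 and Cor. 2.4.2] -/
structure IsAlgCoordSystem (V : X.left.Opens) (f : Fin N → Γ(X.left, V)) : Prop where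
  /-- Every `L`-point lies in `V`. -/
  pt_mem : ∀ P : AlgPoints X L, P.pt ∈ V
  /-- Every `L`-point has an affine chart `W ⊆ V` with denominator `b`. -/
  exists_chart : ∀ P : AlgPoints X L, ∃ (W : X.left.Opens) (hWV : W ≤ V)
    (b : MvPolynomial (Fin N) k), IsAffineOpen W ∧ P.pt ∈ W ∧
      (∀ Q : AlgPoints X L, Q.pt ∈ W ↔ aeval (coordMap L V f Q) b ≠ 0) ∧
      IsUnit (pullbackPoly hWV f b) ∧
      ∀ s : Γ(X.left, W), ∃ (a : MvPolynomial (Fin N) k) (m : ℕ),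
        s * pullbackPoly hWV f b ^ m = pullbackPoly hWV f a

end Defs

/-! ### Values of pulled-back polynomials; continuity and injectivity of the coordinates -/

section Basic

variable {L : Type u} [Field L] [Algebra k L] {V : X.left.Opens} {f : Fin N → Γ(X.left, V)}

/-- Unfolding of `coordMap`. [folklore] -/
theorem coordMap_apply (P : AlgPoints X L) (j : Fin N) :
    coordMap L V f P j = AlgPoints.evalOrZero V (f j) P :=
  rfl

/-- On `V(L)` the `j`-th coordinate is the value of `f_j`. [folklore] -/
theorem coordMap_apply_of_mem {P : AlgPoints X L} (hP : P.pt ∈ V) (j : Fin N) :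
    coordMap L V f P j = P.eval V hP (f j) :=
  AlgPoints.evalOrZero_of_mem _ hP

/-- **The value of `b(f)|_W` at a point of `W(L)` is `b` at the coordinates of the point**:
`(b(f₁, …, f_N)|_W)(Q) = b^L(f₁(Q), …, f_N(Q))` (evaluation is a `k`-algebra homomorphism;
the tree's `AlgPoints.eval_aeval_eq_eval_map` and `evalOrZero_map_homOfLE`). [folklore] -/
theorem eval_pullbackPoly {W : X.left.Opens} (hWV : W ≤ V) (b : MvPolynomial (Fin N) k)
    {Q : AlgPoints X L} (hQ : Q.pt ∈ W) :
    Q.eval W hQ (pullbackPoly hWV f b) = aeval (coordMap L V f Q) b := by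
  letI : Algebra k Γ(X.left, W) := (SchemeOver.scalarRingHom X W).toAlgebra
  have halg : ∀ c, algebraMap k Γ(X.left, W) c = SchemeOver.scalarRingHom X W c := fun _ => rfl
  have h1 : pullbackPoly hWV f b =
      aeval (fun j => X.left.presheaf.map (homOfLE hWV).op (f j)) b := rfl
  rw [h1, AlgPoints.eval_aeval_eq_eval_map halg _ hQ, MvPolynomial.eval_map, ← MvPolynomial.aeval_def]
  have h2 : (fun i => AlgPoints.evalOrZero W (X.left.presheaf.map (homOfLE hWV).op (f i)) Q) =
      coordMap L V f Q :=
    funext fun j => AlgPoints.evalOrZero_map_homOfLE hWV (f j) hQ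
  rw [h2]

/-- The coordinate map is continuous for the strong topology as soon as every `L`-point lies in
`V` (regular functions are continuous on `V(L)` by definition of the strong topology). [folklore] -/
theorem continuous_coordMap [TopologicalSpace L] (hV : ∀ P : AlgPoints X L, P.pt ∈ V) :
    Continuous (coordMap L V f) := by
  refine continuous_pi fun j => ?_
  have h := AlgPoints.continuousOn_evalOrZero (L := L) V (f j)
  rw [show {P : AlgPoints X L | P.pt ∈ V} = univ from eq_univ_of_forall hV,
    continuousOn_univ] at h
  exact h

namespace IsAlgCoordSystem

/-- The coordinate map of an algebraic coordinate system is continuous. [folklore] -/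
theorem continuous [TopologicalSpace L] (hc : IsAlgCoordSystem L V f) :
    Continuous (coordMap L V f) :=
  continuous_coordMap hc.pt_mem

/-- **The coordinates separate `L`-points.** If two `L`-points have the same coordinates they lie
in a common affine chart `W` (membership is read off `b(f(Q)) ≠ 0`), where every regular function
is `a(f)/b(f)^m` and so takes the same value at both; points of an affine open are separated by
its regular functions (`AlgPoints.ext_of_forall_eval_eq`). [cite: AkbulutKing1992, Ch. II §4, Prop. 2.4.1] -/
theorem injective (hc : IsAlgCoordSystem L V f) : Function.Injective (coordMap L V f) := by
  intro P P' h
  obtain ⟨W, hWV, b, hW, hPW, hiff, -, hgen⟩ := hc.exists_chart P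
  have hb : aeval (coordMap L V f P) b ≠ 0 := (hiff P).mp hPW
  have hP'W : P'.pt ∈ W := (hiff P').mpr (h ▸ hb)
  refine AlgPoints.ext_of_forall_eval_eq hW hPW hP'W fun s => ?_
  obtain ⟨a, m, hs⟩ := hgen s
  have e1 := congrArg (P.evalRingHom W hPW) hs
  have e2 := congrArg (P'.evalRingHom W hP'W) hs
  simp only [map_mul, map_pow, AlgPoints.evalRingHom_apply, eval_pullbackPoly] at e1 e2
  rw [← h] at e2
  exact mul_right_cancel₀ (pow_ne_zero m hb) (e1.trans e2.symm)

/-- **Regular functions are rational functions of the coordinates, locally.** For `s ∈ Γ(X, U)`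
and `P ∈ U(L)` there are an open `O ∋ P` of `X` contained in `U` and polynomials
`c, A, B ∈ k[y₁, …, y_N]` such that `O(L) = {Q ∈ X(L) | c(f(Q)) ≠ 0}` and, for every `Q ∈ O(L)`,
`B(f(Q)) ≠ 0` and `s(Q) = A(f(Q))/B(f(Q))`. (In the chart `W ∋ P`: `s = g/hⁿ` on `O = D(h) ⊆ U`
with `g, h ∈ Γ(X, W)` by `AlgPoints.exists_fraction`, and `g = a₂/b^{m₂}`, `h = a₁/b^{m₁}`; take
`c = b a₁`.) This is Serre's Lemme 1 of GAGA §2 n°5 read in the coordinates (Bochnak–Coste–Roy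
§3.2: regular functions on a real algebraic set are locally quotients of polynomials).
[cite: SerreGAGA1956, §2 n°5 Lemme 1] -/
theorem exists_fraction_eval (hc : IsAlgCoordSystem L V f) {U : X.left.Opens}
    (s : Γ(X.left, U)) {P : AlgPoints X L} (hP : P.pt ∈ U) :
    ∃ (O : X.left.Opens) (hOU : O ≤ U) (c A B : MvPolynomial (Fin N) k), P.pt ∈ O ∧
      (∀ Q : AlgPoints X L, Q.pt ∈ O ↔ aeval (coordMap L V f Q) c ≠ 0) ∧
      ∀ (Q : AlgPoints X L) (hQ : Q.pt ∈ O), aeval (coordMap L V f Q) B ≠ 0 ∧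
        Q.eval U (hOU hQ) s = aeval (coordMap L V f Q) A / aeval (coordMap L V f Q) B := by
  obtain ⟨W, hWV, b, hW, hPW, hiff, -, hgen⟩ := hc.exists_chart P
  obtain ⟨g, h', n, hle, hPg, hfrac⟩ := AlgPoints.exists_fraction (L := L) hW s hPW hP
  obtain ⟨a₁, m₁, hg⟩ := hgen g
  obtain ⟨a₂, m₂, hh⟩ := hgen h'
  -- values of `g`, `h'` in terms of the coordinates, on `W(L)`
  have hgv : ∀ (Q : AlgPoints X L) (hQ : Q.pt ∈ W),
      Q.eval W hQ g * aeval (coordMap L V f Q) b ^ m₁ = aeval (coordMap L V f Q) a₁ := by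
    intro Q hQ
    have e := congrArg (Q.evalRingHom W hQ) hg
    simpa only [map_mul, map_pow, AlgPoints.evalRingHom_apply, eval_pullbackPoly] using e
  have hhv : ∀ (Q : AlgPoints X L) (hQ : Q.pt ∈ W),
      Q.eval W hQ h' * aeval (coordMap L V f Q) b ^ m₂ = aeval (coordMap L V f Q) a₂ := by
    intro Q hQ
    have e := congrArg (Q.evalRingHom W hQ) hh
    simpa only [map_mul, map_pow, AlgPoints.evalRingHom_apply, eval_pullbackPoly] using e
  -- `O = D(g)`: its `L`-points are those with `b ≠ 0` (i.e. in `W`) and `a₁ ≠ 0` (i.e. `g ≠ 0`)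
  have hmem : ∀ Q : AlgPoints X L,
      Q.pt ∈ X.left.basicOpen g ↔ aeval (coordMap L V f Q) (b * a₁) ≠ 0 := by
    intro Q
    rw [map_mul]
    constructor
    · intro hQg
      have hQW : Q.pt ∈ W := X.left.basicOpen_le g hQg
      have hb : aeval (coordMap L V f Q) b ≠ 0 := (hiff Q).mp hQW
      have hgQ : Q.eval W hQW g ≠ 0 := (AlgPoints.pt_mem_basicOpen_iff Q hQW g).mp hQg
      refine mul_ne_zero hb ?_
      rw [← hgv Q hQW]
      exact mul_ne_zero hgQ (pow_ne_zero _ hb)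
    · intro hQc
      have hb : aeval (coordMap L V f Q) b ≠ 0 := left_ne_zero_of_mul hQc
      have ha₁ : aeval (coordMap L V f Q) a₁ ≠ 0 := right_ne_zero_of_mul hQc
      have hQW : Q.pt ∈ W := (hiff Q).mpr hb
      have hgQ : Q.eval W hQW g ≠ 0 := by
        intro h0
        have := hgv Q hQW
        rw [h0, zero_mul] at this
        exact ha₁ this.symm
      exact (AlgPoints.pt_mem_basicOpen_iff Q hQW g).mpr hgQ
  refine ⟨X.left.basicOpen g, hle, b * a₁, a₂ * b ^ (m₁ * n), b ^ m₂ * a₁ ^ n, hPg, hmem,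
    fun Q hQg => ?_⟩
  have hQc := (hmem Q).mp hQg
  rw [map_mul] at hQc
  have hb : aeval (coordMap L V f Q) b ≠ 0 := left_ne_zero_of_mul hQc
  have ha₁ : aeval (coordMap L V f Q) a₁ ≠ 0 := right_ne_zero_of_mul hQc
  have hQW : Q.pt ∈ W := (hiff Q).mpr hb
  have hgQ : Q.eval W hQW g ≠ 0 := (AlgPoints.pt_mem_basicOpen_iff Q hQW g).mp hQg
  refine ⟨?_, ?_⟩
  · rw [map_mul, map_pow, map_pow]
    exact mul_ne_zero (pow_ne_zero _ hb) (pow_ne_zero _ ha₁)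
  · have H := hfrac Q hQg
    have e1 := hgv Q hQW
    have e2 := hhv Q hQW
    rw [map_mul, map_mul, map_pow, map_pow, map_pow]
    set sQ := Q.eval U (hle hQg) s
    set gQ := Q.eval W (X.left.basicOpen_le g hQg) g
    set hQ' := Q.eval W (X.left.basicOpen_le g hQg) h'
    set β := aeval (coordMap L V f Q) b
    have hgQ' : gQ = aeval (coordMap L V f Q) a₁ / β ^ m₁ := by
      rw [eq_div_iff (pow_ne_zero _ hb)]
      exact e1
    have hhQ' : hQ' = aeval (coordMap L V f Q) a₂ / β ^ m₂ := by
      rw [eq_div_iff (pow_ne_zero _ hb)]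
      exact e2
    have hsQ : sQ = hQ' / gQ ^ n := by
      rw [eq_div_iff (pow_ne_zero _ hgQ)]
      exact H
    rw [hsQ, hhQ', hgQ', div_pow, ← pow_mul]
    field_simp

/-- **The image of a chart is the projection of an algebraic set.** For a chart `(W, b)` of an
algebraic coordinate system, `Γ(X, W)` is generated over `k` by `f₁|_W, …, f_N|_W` and
`u = (b(f)|_W)⁻¹`, so it has a finite presentation `k[y₁, …, y_N, u]/(G)` (Hilbert's basis
theorem), and the `L`-points of the affine `W` are the zeros of `G` in `L^{N+1}` (the tree's
`AlgPoints.exists_evalOrZero_val_eq`, `eval_map_relation_eq_zero`): the image of `W(L)` under the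
coordinates is the projection of `{w ∈ L^{N+1} | r(w) = 0 ∀ r ∈ G}` to the first `N` coordinates.
(Bochnak–Coste–Roy Prop. 2.2.7 / §3.2; Mumford, *Red Book* I §10, points of an affine variety.)
[cite: BochnakCosteRoy1998, Prop. 2.2.7] -/
theorem exists_image_chart_eq {W : X.left.Opens} (hWV : W ≤ V) {b : MvPolynomial (Fin N) k}
    (hW : IsAffineOpen W) (hunit : IsUnit (pullbackPoly hWV f b))
    (hgen : ∀ s : Γ(X.left, W), ∃ (a : MvPolynomial (Fin N) k) (m : ℕ),
      s * pullbackPoly hWV f b ^ m = pullbackPoly hWV f a) :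
    ∃ G : Finset (MvPolynomial (Fin (N + 1)) k),
      coordMap L V f '' {Q | Q.pt ∈ W} =
        (fun w : Fin (N + 1) → L => w ∘ Fin.castSucc) ''
          {w | ∀ r ∈ G, aeval w r = 0} := by
  classical
  letI : Algebra k Γ(X.left, W) := (SchemeOver.scalarRingHom X W).toAlgebra
  have halg : ∀ c, algebraMap k Γ(X.left, W) c = SchemeOver.scalarRingHom X W c := fun _ => rfl
  -- generators: the restricted coordinates and the inverse `u` of `b(f)|_W`
  set u : Γ(X.left, W) := ↑(hunit.unit⁻¹) with hu
  have hbu : pullbackPoly hWV f b * u = 1 := by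
    rw [hu]
    exact hunit.mul_val_inv
  let val : Fin (N + 1) → Γ(X.left, W) :=
    Fin.snoc (fun j => X.left.presheaf.map (homOfLE hWV).op (f j)) u
  have hval_cast : ∀ j, val (Fin.castSucc j) = X.left.presheaf.map (homOfLE hWV).op (f j) :=
    fun j => by simp [val]
  have hval_last : val (Fin.last N) = u := by simp [val]
  have hpb : ∀ a : MvPolynomial (Fin N) k,
      aeval val (rename Fin.castSucc a) = pullbackPoly hWV f a := by
    intro a
    rw [aeval_rename]
    have : val ∘ Fin.castSucc = fun j => X.left.presheaf.map (homOfLE hWV).op (f j) :=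
      funext hval_cast
    rw [this]
    rfl
  choose a m ham using hgen
  let P : Algebra.Generators k Γ(X.left, W) (Fin (N + 1)) :=
    { val := val
      σ' := fun s => rename Fin.castSucc (a s) * MvPolynomial.X (Fin.last N) ^ m s
      aeval_val_σ' := fun s => by
        rw [map_mul, map_pow, hpb, aeval_X, hval_last]
        calc pullbackPoly hWV f (a s) * u ^ m s
            = s * pullbackPoly hWV f b ^ m s * u ^ m s := by rw [ham s]
          _ = s * (pullbackPoly hWV f b * u) ^ m s := by rw [mul_pow, mul_assoc]
          _ = s := by rw [hbu, one_pow, mul_one] }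
  -- relations: a finite generating set of the kernel (Hilbert basis theorem)
  obtain ⟨G, hG⟩ : P.ker.FG := IsNoetherian.noetherian _
  let Pr : Algebra.Presentation k Γ(X.left, W) (Fin (N + 1))
      (↥(G : Set (MvPolynomial (Fin (N + 1)) k))) :=
    { toGenerators := P
      relation := fun r => (r : MvPolynomial (Fin (N + 1)) k)
      span_range_relation_eq_ker := by
        rw [Subtype.range_coe_subtype]
        exact hG }
  refine ⟨G, ?_⟩
  ext v
  simp only [mem_image, mem_setOf_eq]
  constructor
  · rintro ⟨Q, hQ, rfl⟩
    refine ⟨fun i => AlgPoints.evalOrZero W (val i) Q, fun r hr => ?_, ?_⟩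
    · have h := AlgPoints.eval_map_relation_eq_zero (L := L) halg Pr hQ ⟨r, hr⟩
      rwa [MvPolynomial.eval_map, ← MvPolynomial.aeval_def] at h
    · funext j
      simp only [Function.comp_apply, hval_cast]
      exact AlgPoints.evalOrZero_map_homOfLE hWV (f j) hQ
  · rintro ⟨w, hw, rfl⟩
    have hz : ∀ r : ↥(G : Set (MvPolynomial (Fin (N + 1)) k)),
        MvPolynomial.eval w (MvPolynomial.map (algebraMap k L) (Pr.relation r)) = 0 := by
      intro r
      rw [MvPolynomial.eval_map, ← MvPolynomial.aeval_def]
      exact hw r.1 r.2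
    obtain ⟨Q, hQ, hQw⟩ := AlgPoints.exists_evalOrZero_val_eq (L := L) halg hW Pr w hz
    refine ⟨Q, hQ, ?_⟩
    funext j
    have h := congr_fun hQw (Fin.castSucc j)
    simp only [Function.comp_apply] at h ⊢
    rw [← h]
    change AlgPoints.evalOrZero V (f j) Q = AlgPoints.evalOrZero W (val (Fin.castSucc j)) Q
    rw [hval_cast]
    exact (AlgPoints.evalOrZero_map_homOfLE hWV (f j) hQ).symm

end IsAlgCoordSystem

end Basic

/-! ### Proper schemes: the coordinates are a closed embedding -/

section Topology

variable {L : Type u} [NontriviallyNormedField L] [Algebra k L] {V : X.left.Opens}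
  {f : Fin N → Γ(X.left, V)}

/-- **For `X` proper the coordinates are a closed embedding of `X(L)` into `L^N`** (`L` a
locally compact nontrivially normed field, e.g. `ℝ`, `ℂ`): a continuous injection from the compact
space `X(L)` (the tree's `compactSpace_algPoints_of_isProper_holds`; Serre GAGA §2 Prop. 6,
Conrad Prop. 2.1/§5) to a Hausdorff space. For `X ⊆ ℙⁿ` and the coordinates `x_a x_b/Σ x_c²`
this is the affine embedding of a projective real algebraic set (Akbulut–King II Cor. 2.4.2).
[cite: AkbulutKing1992, Ch. II §4, Cor. 2.4.2] -/
theorem IsAlgCoordSystem.isClosedEmbedding [LocallyCompactSpace L] [IsProper X.hom]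
    (hc : IsAlgCoordSystem L V f) : IsClosedEmbedding (coordMap L V f) := by
  haveI : CompactSpace (AlgPoints X L) := compactSpace_algPoints_of_isProper_holds X L
  exact hc.continuous.isClosedEmbedding hc.injective

/-- For `X` proper the image of `X(L)` under the coordinates is compact. [cite: AkbulutKing1992, Ch. II §4, Cor. 2.4.2] -/
theorem IsAlgCoordSystem.isCompact_range [LocallyCompactSpace L] [IsProper X.hom]
    (hc : IsAlgCoordSystem L V f) : IsCompact (range (coordMap L V f)) := by
  haveI : CompactSpace (AlgPoints X L) := compactSpace_algPoints_of_isProper_holds X L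
  exact _root_.isCompact_range hc.continuous

end Topology

end General

/-! ### Real points: semialgebraic images and semialgebraic regular functions -/

section Real

variable {k : Type} [Field k] [Algebra k ℝ] {X : SchemeOver k} {N : ℕ} {V : X.left.Opens}
  {f : Fin N → Γ(X.left, V)}

/-- A subset of the underlying space of a Noetherian scheme covered by a family of opens is
covered by finitely many of them (every subset of a Noetherian space is compact). [folklore] -/
theorem exists_finset_cover_of_noetherianSpace {Y : Scheme} [NoetherianSpace Y] {α : Type*}
    (T : Set Y) (W : α → Y.Opens) (hcover : ∀ x ∈ T, ∃ a, x ∈ W a) :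
    ∃ s : Finset α, ∀ x ∈ T, ∃ a ∈ s, x ∈ W a := by
  have hT : IsCompact T := NoetherianSpace.isCompact T
  obtain ⟨s, hs⟩ := hT.elim_finite_subcover (fun a => (W a : Set Y)) (fun a => (W a).isOpen)
    (fun x hx => by
      obtain ⟨a, ha⟩ := hcover x hx
      exact mem_iUnion.mpr ⟨a, ha⟩)
  refine ⟨s, fun x hx => ?_⟩
  obtain ⟨a, ha⟩ := mem_iUnion.mp (hs hx)
  obtain ⟨has, hxa⟩ := mem_iUnion.mp ha
  exact ⟨a, has, hxa⟩

namespace IsAlgCoordSystem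

/-- **The image of the real points is semialgebraic.** For `X` Noetherian (e.g. of finite type
over `k`), the image of `X(ℝ)` under an algebraic coordinate system is a `k`-semialgebraic subset
of `ℝ^N`: finitely many charts cover the real points, and the image of each is the projection of a
real algebraic set (`exists_image_chart_eq`), semialgebraic by the Tarski–Seidenberg theorem (the
tree's `IsSemialgebraic.image_comp`). (Bochnak–Coste–Roy Prop. 2.2.7; for `X ⊆ ℙⁿ` the image is
even a real algebraic set, Akbulut–King II Prop. 2.4.1.) [cite: BochnakCosteRoy1998, Prop. 2.2.7] -/
theorem isSemialgebraic_range [NoetherianSpace X.left] (hc : IsAlgCoordSystem ℝ V f) :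
    IsSemialgebraic k (range (coordMap ℝ V f)) := by
  classical
  choose W hWV b hW hPW hiff hunit hgen using hc.exists_chart
  obtain ⟨s, hs⟩ := exists_finset_cover_of_noetherianSpace
    (range (AlgPoints.pt (X := X) (L := ℝ))) W (by
      rintro x ⟨P, rfl⟩
      exact ⟨P, hPW P⟩)
  have hU : range (coordMap ℝ V f) = ⋃ P ∈ s, coordMap ℝ V f '' {Q | Q.pt ∈ W P} := by
    ext v
    simp only [mem_range, mem_iUnion, mem_image, mem_setOf_eq, exists_prop]
    constructor
    · rintro ⟨Q, rfl⟩
      obtain ⟨P, hPs, hQP⟩ := hs Q.pt ⟨Q, rfl⟩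
      exact ⟨P, hPs, Q, hQP, rfl⟩
    · rintro ⟨P, -, Q, -, rfl⟩
      exact ⟨Q, rfl⟩
  rw [hU]
  refine IsSemialgebraic.biUnion s _ fun P _ => ?_
  obtain ⟨G, hG⟩ := exists_image_chart_eq (L := ℝ) (hWV P) (hW P) (hunit P) (hgen P)
  rw [hG]
  refine IsSemialgebraic.image_comp Fin.castSucc ?_
  have : {w : Fin (N + 1) → ℝ | ∀ r ∈ G, aeval w r = 0} =
      ⋂ r ∈ G, {w | aeval w r = 0} := by
    ext w
    simp
  rw [this]
  exact IsSemialgebraic.biInter G _ fun r _ => isSemialgebraic_setOf_eval_eq_zero r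

/-- **The image of `U(ℝ)` is semialgebraic for every open `U ⊆ X`** (`X` Noetherian): the real
points of `U` are covered by finitely many opens `O` on each of which membership is a polynomial
condition `c(f(Q)) ≠ 0` (`exists_fraction_eval`), so the image of `U(ℝ)` is the image of `X(ℝ)`
cut by `⋁ᵢ cᵢ ≠ 0`. [cite: BochnakCosteRoy1998, Prop. 2.2.7] -/
theorem isSemialgebraic_image [NoetherianSpace X.left] (hc : IsAlgCoordSystem ℝ V f)
    (U : X.left.Opens) : IsSemialgebraic k (coordMap ℝ V f '' {Q | Q.pt ∈ U}) := by
  classical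
  have key := fun P : {P : AlgPoints X ℝ // P.pt ∈ U} =>
    hc.exists_fraction_eval (U := U) (0 : Γ(X.left, U)) P.2
  choose O hOU c A B hPO hmem hval using key
  obtain ⟨s, hs⟩ := exists_finset_cover_of_noetherianSpace
    {x | ∃ P : {P : AlgPoints X ℝ // P.pt ∈ U}, P.1.pt = x} O (by
      rintro x ⟨P, rfl⟩
      exact ⟨P, hPO P⟩)
  have hU : coordMap ℝ V f '' {Q | Q.pt ∈ U} =
      range (coordMap ℝ V f) ∩ ⋃ P ∈ s, {v | aeval v (c P) ≠ 0} := by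
    ext v
    simp only [mem_image, mem_setOf_eq, mem_inter_iff, mem_range, mem_iUnion, exists_prop]
    constructor
    · rintro ⟨Q, hQ, rfl⟩
      obtain ⟨P, hPs, hQP⟩ := hs Q.pt ⟨⟨Q, hQ⟩, rfl⟩
      exact ⟨⟨Q, rfl⟩, P, hPs, (hmem P Q).mp hQP⟩
    · rintro ⟨⟨Q, rfl⟩, P, -, hQc⟩
      exact ⟨Q, hOU P ((hmem P Q).mpr hQc), rfl⟩
  rw [hU]
  exact hc.isSemialgebraic_range.inter
    (IsSemialgebraic.biUnion s _ fun P _ => isSemialgebraic_setOf_eval_ne_zero (c P))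

/-- **Regular functions are semialgebraic functions of the coordinates.** For `X` Noetherian and
`s ∈ Γ(X, U)` there is a function `F : ℝ^N → ℝ`, `k`-semialgebraic on the image of `U(ℝ)`, with
`F(f(Q)) = s(Q)` for all `Q ∈ U(ℝ)`: on finitely many pieces `{cᵢ ≠ 0}` covering the image of
`U(ℝ)` it is the rational function `Aᵢ/Bᵢ` (`exists_fraction_eval`), so its graph is a finite
union of sets `{(v, t) | v ∈ f(X(ℝ)), cᵢ(v) ≠ 0, t Bᵢ(v) = Aᵢ(v)}`. (Bochnak–Coste–Roy §3.2 with
Prop. 2.2.7: regular functions on real algebraic sets are semialgebraic.) [cite: BochnakCosteRoy1998, Prop. 2.2.7] -/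
theorem exists_isSemialgebraicFunOn_eval [NoetherianSpace X.left] (hc : IsAlgCoordSystem ℝ V f)
    {U : X.left.Opens} (s : Γ(X.left, U)) :
    ∃ F : (Fin N → ℝ) → ℝ, IsSemialgebraicFunOn k (coordMap ℝ V f '' {Q | Q.pt ∈ U}) F ∧
      ∀ (Q : AlgPoints X ℝ) (hQ : Q.pt ∈ U), F (coordMap ℝ V f Q) = Q.eval U hQ s := by
  classical
  -- the function: value of `s` at the (unique) point with the given coordinates
  let F : (Fin N → ℝ) → ℝ := fun v =>
    if h : ∃ Q : AlgPoints X ℝ, Q.pt ∈ U ∧ coordMap ℝ V f Q = v then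
      h.choose.eval U h.choose_spec.1 s else 0
  have hF : ∀ (Q : AlgPoints X ℝ) (hQ : Q.pt ∈ U), F (coordMap ℝ V f Q) = Q.eval U hQ s := by
    intro Q hQ
    have h : ∃ Q' : AlgPoints X ℝ, Q'.pt ∈ U ∧ coordMap ℝ V f Q' = coordMap ℝ V f Q :=
      ⟨Q, hQ, rfl⟩
    simp only [F, dif_pos h]
    have hQ' : h.choose = Q := hc.injective h.choose_spec.2
    have : ∀ (Q'' : AlgPoints X ℝ) (_ : Q'' = Q) (h'' : Q''.pt ∈ U),
        Q''.eval U h'' s = Q.eval U hQ s := by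
      rintro Q'' rfl h''
      rfl
    exact this _ hQ' _
  refine ⟨F, ?_, hF⟩
  -- local fractions on finitely many pieces
  have key := fun P : {P : AlgPoints X ℝ // P.pt ∈ U} =>
    hc.exists_fraction_eval (U := U) s P.2
  choose O hOU c A B hPO hmem hval using key
  obtain ⟨t, ht⟩ := exists_finset_cover_of_noetherianSpace
    {x | ∃ P : {P : AlgPoints X ℝ // P.pt ∈ U}, P.1.pt = x} O (by
      rintro x ⟨P, rfl⟩
      exact ⟨P, hPO P⟩)
  rw [isSemialgebraicFunOn_iff]
  have hgraph : {z : Fin (N + 1) → ℝ | Fin.init z ∈ coordMap ℝ V f '' {Q | Q.pt ∈ U} ∧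
      z (Fin.last N) = F (Fin.init z)} =
      ⋃ P ∈ t, ({z : Fin (N + 1) → ℝ | Fin.init z ∈ range (coordMap ℝ V f)} ∩
        ({z : Fin (N + 1) → ℝ | aeval (Fin.init z) (c P) ≠ 0} ∩
          {z : Fin (N + 1) → ℝ |
            z (Fin.last N) * aeval (Fin.init z) (B P) = aeval (Fin.init z) (A P)})) := by
    ext z
    simp only [mem_setOf_eq, mem_iUnion, mem_inter_iff, mem_image, mem_range, exists_prop]
    constructor
    · rintro ⟨⟨Q, hQ, hQz⟩, hz⟩
      obtain ⟨P, hPt, hQP⟩ := ht Q.pt ⟨⟨Q, hQ⟩, rfl⟩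
      obtain ⟨hB, hsv⟩ := hval P Q hQP
      refine ⟨P, hPt, ⟨Q, hQz⟩, ?_, ?_⟩
      · rw [← hQz]
        exact (hmem P Q).mp hQP
      · rw [hz, ← hQz, hF Q hQ, hsv, div_mul_cancel₀ _ hB]
    · rintro ⟨P, -, ⟨Q, hQz⟩, hcz, hzAB⟩
      rw [← hQz] at hcz hzAB
      have hQO : Q.pt ∈ O P := (hmem P Q).mpr hcz
      obtain ⟨hB, hsv⟩ := hval P Q hQO
      refine ⟨⟨Q, hOU P hQO, hQz⟩, ?_⟩
      rw [← hQz, hF Q (hOU P hQO), hsv, eq_div_iff hB]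
      exact hzAB
  rw [hgraph]
  refine IsSemialgebraic.biUnion t _ fun P _ => ?_
  refine (hc.isSemialgebraic_range.preimage_comp Fin.castSucc).inter (IsSemialgebraic.inter ?_ ?_)
  · have h := isSemialgebraic_setOf_eval_ne_zero (R := ℝ) (rename Fin.castSucc (c P))
    convert h using 2 with z
    simp only [aeval_rename]
    rfl
  · have h := isSemialgebraic_setOf_eval_eq_zero (R := ℝ)
      (MvPolynomial.X (Fin.last N) * rename Fin.castSucc (B P) - rename Fin.castSucc (A P))
    convert h using 2 with z
    simp only [map_sub, map_mul, aeval_X, aeval_rename, sub_eq_zero]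
    rfl

/-- **Regular functions are real-analytic functions of the coordinates, locally.** For
`s ∈ Γ(X, U)` and `P ∈ U(ℝ)` there are an open `k`-semialgebraic set `O ⊆ ℝ^N` containing `f(P)`
and a function `G : ℝ^N → ℝ`, real-analytic at every point of `O` (a quotient of polynomials with
non-vanishing denominator), such that every real point `Q` with `f(Q) ∈ O` lies in `U` and has
`s(Q) = G(f(Q))`. (Serre GAGA §2 n°5 Lemme 1 c): regular ⇒ analytic in algebraic coordinates;
Bochnak–Coste–Roy §3.2 / Def. 2.9.3: regular functions are Nash.) [cite: SerreGAGA1956, §2 n°5 Lemme 1] -/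
theorem exists_analyticOnNhd_eval (hc : IsAlgCoordSystem ℝ V f) {U : X.left.Opens}
    (s : Γ(X.left, U)) {P : AlgPoints X ℝ} (hP : P.pt ∈ U) :
    ∃ (O : Set (Fin N → ℝ)) (G : (Fin N → ℝ) → ℝ), IsOpen O ∧ IsSemialgebraic k O ∧
      coordMap ℝ V f P ∈ O ∧ AnalyticOnNhd ℝ G O ∧
      ∀ Q : AlgPoints X ℝ, coordMap ℝ V f Q ∈ O →
        ∃ hQ : Q.pt ∈ U, Q.eval U hQ s = G (coordMap ℝ V f Q) := by
  obtain ⟨O, hOU, c, A, B, hPO, hmem, hval⟩ := hc.exists_fraction_eval s hP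
  let cR : MvPolynomial (Fin N) ℝ := MvPolynomial.map (algebraMap k ℝ) c
  let AR : MvPolynomial (Fin N) ℝ := MvPolynomial.map (algebraMap k ℝ) A
  let BR : MvPolynomial (Fin N) ℝ := MvPolynomial.map (algebraMap k ℝ) B
  have hcR : (fun v => aeval v c) = fun v => MvPolynomial.eval v cR := funext fun v => by
    rw [MvPolynomial.eval_map, ← MvPolynomial.aeval_def]
  have hAR : (fun v => aeval v A) = fun v => MvPolynomial.eval v AR := funext fun v => by
    rw [MvPolynomial.eval_map, ← MvPolynomial.aeval_def]
  have hBR : (fun v => aeval v B) = fun v => MvPolynomial.eval v BR := funext fun v => by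
    rw [MvPolynomial.eval_map, ← MvPolynomial.aeval_def]
  refine ⟨{v | aeval v c ≠ 0} ∩ {v | aeval v B ≠ 0}, fun v => aeval v A / aeval v B,
    ?_, ?_, ?_, ?_, fun Q hQ => ?_⟩
  · refine IsOpen.inter ?_ ?_
    · change IsOpen ((fun v => aeval v c) ⁻¹' {a | a ≠ 0})
      rw [hcR]
      exact (MvPolynomial.continuous_eval cR).isOpen_preimage _ isOpen_ne
    · change IsOpen ((fun v => aeval v B) ⁻¹' {a | a ≠ 0})
      rw [hBR]
      exact (MvPolynomial.continuous_eval BR).isOpen_preimage _ isOpen_ne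
  · exact (isSemialgebraic_setOf_eval_ne_zero c).inter (isSemialgebraic_setOf_eval_ne_zero B)
  · exact ⟨(hmem P).mp hPO, (hval P hPO).1⟩
  · rintro v ⟨-, hvB⟩
    have hA : AnalyticAt ℝ (fun v => aeval v A) v := by
      rw [hAR]
      exact (AnalyticOnNhd.eval_mvPolynomial AR) v (mem_univ _)
    have hB : AnalyticAt ℝ (fun v => aeval v B) v := by
      rw [hBR]
      exact (AnalyticOnNhd.eval_mvPolynomial BR) v (mem_univ _)
    exact hA.div hB hvB
  · have hQO : Q.pt ∈ O := (hmem Q).mpr hQ.1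
    exact ⟨hOU hQO, (hval Q hQO).2⟩

end IsAlgCoordSystem

end Real


end Literature.AlgebraicGeometry.RealAlgebraic

end
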